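import Literature.NumberTheory.DiophantineGeometry.GenEllConjugateCompactness
import Mathlib.Analysis.Normed.Group.Ultra
import Mathlib.Analysis.Normed.Module.FiniteDimension
import Mathlib.NumberTheory.Padics.ProperSpace
import HarnessLib

/-!
# `p`-adic separation from the ramification locus bounds `‖N(P)‖_p` below (GenEllTwo, W5b-padic)

Support for `Summit.ABC.ABC.Theses.IUTThetaPilot.GenEllTwo` = [GenEll] Thm. 2.1 (ii) ⇒ (i) for
`(ℙ¹, [0]+[1]+[∞])` (S. Mochizuki, *Arithmetic elliptic curves in general position*, Math. J. Okayama
Univ. 52 (2010), Thm. 2.1, proof p. 12: "the compactness of the set of rational points of `X` over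
any finite extension of `ℚ_v` for `v ∈ V`" [cite: MochizukiGenEll2010]), in the abc-iut cell's
number-field-only architecture (`GENELLTWO-P1ROUTE.md` §2–§3): curve `D_e : r^{2k+1} = x(1 − x)`,
ramification function `N = r²s³·dt/dr = −(1−2x)³ + (k+1)r^{k+2} − 2r^{3k+3}` of
`t = (s + r^{k+2})/(r·s)`, `s = 1 − 2x` (written out inline; equal to `DeCrit.Nval` / `DeArch.N`).

The κ-summation of §3 (d) of that note spends the ramification credit `ord⁺_w N(P)` at every finite
place; at the finitely many places `v ∈ V` where the good-prime analysis does not apply (`v ∣ 2`, and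
the bad primes of `(e, B)`), the credit must instead be BOUNDED, using that the conjugates of `P` stay
`ρ`-far from the ramification points `R_t` (⊆ `E_φ`). This file proves that bound in embedding
language (nonarchimedean twin of `GenEllDeRamificationArch.exists_pos_le_norm_N_of_separated`):

* `norm_snd_le_four`, `norm_fst_le` — ultrametric growth: on `D_e` over an ultrametric field with
  `‖2‖ ≥ 1/2`, `‖N‖ ≤ 1 ⇒ ‖r‖ ≤ 4 ⇒ ‖x‖ ≤ 4^{2k+1}`;
* `exists_pos_le_norm_of_separated` — for a finite `L ⊆ ℚ̄_p` over `ℚ_p` and `ρ > 0`: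
  `∃ c > 0`, every `P ∈ D_e(L)` whose `ρ`-neighbourhood in `ℚ̄_p²` contains no zero of `N` on
  `D_e(ℚ̄_p)` has `c ≤ ‖N(P)‖` (compactness of `{‖N‖ ≤ 1} ∩ D_e(L)`, `L` locally compact);
* `exists_pos_le_norm_embedding_of_separated` (+ `_of_subset`) — **for number fields `F` with
  `[F:ℚ] ≤ d`: `∃ c > 0`, for all `(x, r) ∈ D_e(F)` and all `σ : F → ℚ̄_p` with `(σ x, σ r)` `ρ`-far
  from the zeros of `N` (or from any `Z ⊇` them), `c ≤ ‖σ(N(x, r))‖`** (Krasner finiteness: all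
  conjugates in degree `≤ d` lie in one finite `L`, tree `exists_intermediateField_forall_conj_mem`).

Combine with `PadicEmbedding.sum_toNat_ord_mul_logNorm_le_of_forall_embedding` to get
`Σ_{w ∣ p} ord⁺_w N(P)·log N(w) ≤ [F:ℚ]·log c⁻¹`. Theorems only; no named facts. Nothing here bears
on the disputed parts of the abc-iut corpus ([GenEll] is refereed and granted by all sides).
-/

noncomputable section

open Metric

namespace Literature.NumberTheory.DiophantineGeometry.GenEll

namespace DePadic

/-! ## Ultrametric growth of `N = −s³ + (k+1)r^{k+2} − 2r^{3k+3}` on `D_e` -/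

section Growth

variable {E : Type*} [NormedField E] [IsUltrametricDist E]

/-- On `D_e : r^{2k+1} = x(1 − x)` over an ultrametric field with `‖2‖ ≥ 1/2` (e.g. `ℚ̄_p`), a point
with `‖r‖ > 4` has `‖N‖ > 1`, `N = −(1−2x)³ + (k+1)r^{k+2} − 2r^{3k+3}`: the term `2r^{3k+3}`
strictly dominates. Contrapositive form: `‖N‖ ≤ 1 ⇒ ‖r‖ ≤ 4`.
[cite: MochizukiGenEll2010, Thm 2.1 proof p.12] -/
theorem norm_snd_le_four (h2 : (1 : ℝ) / 2 ≤ ‖(2 : E)‖) (k : ℕ) {x r : E}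
    (hc : r ^ (2 * k + 1) = x * (1 - x))
    (hN : ‖-(1 - 2 * x) ^ 3 + (((k : E) + 1) * r ^ (k + 2) - 2 * r ^ (3 * k + 3))‖ ≤ 1) :
    ‖r‖ ≤ 4 := by
  by_contra hr
  rw [not_le] at hr
  have h2le : ‖(2 : E)‖ ≤ 1 := by simpa using IsUltrametricDist.norm_natCast_le_one E 2
  have h2pos : 0 < ‖(2 : E)‖ := lt_of_lt_of_le (by norm_num) h2
  have hr1 : 1 ≤ ‖r‖ := by linarith
  have hr0 : 0 < ‖r‖ := by linarith
  -- `s² = 1 − 4r^e`, `‖s‖² = ‖4r^e‖ = ‖2‖²‖r‖^e`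
  have hs2 : (1 - 2 * x) ^ 2 = 1 + -(4 * r ^ (2 * k + 1)) := by linear_combination 4 * hc
  have h4 : (4 : E) = 2 ^ 2 := by norm_num
  have hnorm4r : ‖-(4 * r ^ (2 * k + 1))‖ = ‖(2 : E)‖ ^ 2 * ‖r‖ ^ (2 * k + 1) := by
    rw [norm_neg, norm_mul, h4, norm_pow, norm_pow]
  have hbig : 1 < ‖(2 : E)‖ ^ 2 * ‖r‖ ^ (2 * k + 1) := by
    have hA : (1 : ℝ) / 4 ≤ ‖(2 : E)‖ ^ 2 := by nlinarith
    have hB : (4 : ℝ) < ‖r‖ ^ (2 * k + 1) :=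
      lt_of_lt_of_le hr (le_self_pow₀ hr1 (by omega))
    nlinarith
  have hs_sq : ‖1 - 2 * x‖ ^ 2 = ‖(2 : E)‖ ^ 2 * ‖r‖ ^ (2 * k + 1) := by
    rw [← norm_pow, hs2, IsUltrametricDist.norm_add_eq_max_of_norm_ne_norm, norm_one, hnorm4r,
      max_eq_right hbig.le]
    rw [norm_one, hnorm4r]
    exact hbig.ne
  -- the three terms
  set A := ‖-(1 - 2 * x) ^ 3‖ with hA
  set B := ‖(2 : E) * r ^ (3 * k + 3)‖ with hB
  set C := ‖((k : E) + 1) * r ^ (k + 2)‖ with hC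
  have hBval : B = ‖(2 : E)‖ * ‖r‖ ^ (3 * k + 3) := by rw [hB, norm_mul, norm_pow]
  have hB0 : 0 ≤ B := norm_nonneg _
  have hAval : A ^ 2 = ‖(2 : E)‖ ^ 6 * ‖r‖ ^ (6 * k + 3) := by
    rw [hA, norm_neg, norm_pow, ← pow_mul, show 3 * 2 = 2 * 3 by norm_num, pow_mul, hs_sq]
    ring
  have hAB : A < B := by
    have hsq : A ^ 2 < B ^ 2 := by
      rw [hAval, hBval, mul_pow, ← pow_mul]
      have h24 : ‖(2 : E)‖ ^ 4 ≤ 1 := pow_le_one₀ (norm_nonneg _) h2le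
      have hr3 : (64 : ℝ) < ‖r‖ ^ 3 := by
        have := pow_lt_pow_left₀ hr (by norm_num) (three_ne_zero)
        norm_num at this
        exact this
      have hpos : 0 < ‖(2 : E)‖ ^ 2 * ‖r‖ ^ (6 * k + 3) := by positivity
      have : ‖(2 : E)‖ ^ 6 * ‖r‖ ^ (6 * k + 3) = (‖(2 : E)‖ ^ 2 * ‖r‖ ^ (6 * k + 3)) * ‖(2 : E)‖ ^ 4 := by
        ring
      have : ‖(2 : E)‖ ^ 2 * ‖r‖ ^ ((3 * k + 3) * 2) =
          (‖(2 : E)‖ ^ 2 * ‖r‖ ^ (6 * k + 3)) * ‖r‖ ^ 3 := by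
        rw [show (3 * k + 3) * 2 = 6 * k + 3 + 3 by ring, pow_add]; ring
      nlinarith
    exact lt_of_pow_lt_pow_left₀ 2 hB0 hsq
  have hCB : C < B := by
    have hC1 : C ≤ ‖r‖ ^ (k + 2) := by
      rw [hC, norm_mul, norm_pow]
      have hk : ‖((k : E) + 1)‖ ≤ 1 := by simpa using IsUltrametricDist.norm_natCast_le_one E (k + 1)
      calc ‖(k : E) + 1‖ * ‖r‖ ^ (k + 2) ≤ 1 * ‖r‖ ^ (k + 2) :=
            mul_le_mul_of_nonneg_right hk (by positivity)
        _ = ‖r‖ ^ (k + 2) := one_mul _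
    refine lt_of_le_of_lt hC1 ?_
    have hD : (1 : ℝ) < ‖(2 : E)‖ * ‖r‖ ^ (2 * k + 1) := by
      have : (4 : ℝ) < ‖r‖ ^ (2 * k + 1) := lt_of_lt_of_le hr (le_self_pow₀ hr1 (by omega))
      nlinarith
    have hpos : 0 < ‖r‖ ^ (k + 2) := by positivity
    have hsplit : ‖(2 : E)‖ * ‖r‖ ^ (3 * k + 3) = (‖(2 : E)‖ * ‖r‖ ^ (2 * k + 1)) * ‖r‖ ^ (k + 2) := by
      ring
    rw [hBval, hsplit]
    exact lt_mul_of_one_lt_left hpos hD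
  -- ultrametric: the dominant term wins
  have hinner : ‖((k : E) + 1) * r ^ (k + 2) - 2 * r ^ (3 * k + 3)‖ = B := by
    rw [sub_eq_add_neg, IsUltrametricDist.norm_add_eq_max_of_norm_ne_norm, norm_neg,
      max_eq_right hCB.le]
    rw [norm_neg]; exact hCB.ne
  have hN' : ‖-(1 - 2 * x) ^ 3 + (((k : E) + 1) * r ^ (k + 2) - 2 * r ^ (3 * k + 3))‖ = B := by
    rw [IsUltrametricDist.norm_add_eq_max_of_norm_ne_norm, hinner, max_eq_right hAB.le]
    rw [hinner]; exact hAB.ne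
  have hB1 : 1 < B := by
    rw [hBval]
    have : (4 : ℝ) < ‖r‖ ^ (3 * k + 3) := lt_of_lt_of_le hr (le_self_pow₀ hr1 (by omega))
    nlinarith
  rw [hN'] at hN
  exact absurd hN (not_le.mpr hB1)

/-- On `D_e`, `‖r‖ ≤ 4` forces `‖x‖ ≤ 4^{2k+1}` (ultrametric: `‖x‖ > 1 ⇒ ‖x(1−x)‖ = ‖x‖²`).
[cite: MochizukiGenEll2010, Thm 2.1 proof p.12] -/
theorem norm_fst_le (k : ℕ) {x r : E} (hc : r ^ (2 * k + 1) = x * (1 - x)) (hr : ‖r‖ ≤ 4) :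
    ‖x‖ ≤ 4 ^ (2 * k + 1) := by
  have h4 : (1 : ℝ) ≤ 4 ^ (2 * k + 1) := one_le_pow₀ (by norm_num)
  rcases le_or_gt ‖x‖ 1 with hx | hx
  · exact hx.trans h4
  · have h1x : ‖1 - x‖ = ‖x‖ := by
      rw [sub_eq_add_neg, IsUltrametricDist.norm_add_eq_max_of_norm_ne_norm, norm_one, norm_neg,
        max_eq_right hx.le]
      rw [norm_one, norm_neg]; exact hx.ne
    have hxx : ‖x‖ * ‖x‖ = ‖r‖ ^ (2 * k + 1) := by
      calc ‖x‖ * ‖x‖ = ‖x‖ * ‖1 - x‖ := by rw [h1x]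
        _ = ‖x * (1 - x)‖ := (norm_mul _ _).symm
        _ = ‖r‖ ^ (2 * k + 1) := by rw [← hc, norm_pow]
    have hre : ‖r‖ ^ (2 * k + 1) ≤ 4 ^ (2 * k + 1) :=
      pow_le_pow_left₀ (norm_nonneg _) hr _
    nlinarith

end Growth

/-! ## The separation lemma over `ℚ̄_p` -/

variable (p : ℕ) [Fact p.Prime]

/-- `‖2‖ ≥ 1/2` in `ℚ̄_p` (`= 1/2` for `p = 2`, `= 1` otherwise). [folklore] -/
private theorem half_le_norm_two : (1 : ℝ) / 2 ≤ ‖(2 : PadicAlgCl p)‖ := by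
  have h : ((2 : ℕ) : PadicAlgCl p) = algebraMap ℚ_[p] (PadicAlgCl p) ((2 : ℕ) : ℚ_[p]) := by
    rw [map_natCast]
  have h2 : ‖(2 : PadicAlgCl p)‖ = ‖((2 : ℕ) : ℚ_[p])‖ := by
    rw [show (2 : PadicAlgCl p) = ((2 : ℕ) : PadicAlgCl p) by norm_num, h, norm_algebraMap']
  rw [h2]
  -- `‖(2 : ℚ_p)‖ = p^{-v_p(2)} ≥ 2^{-1}`
  by_cases hp : p = 2
  · subst hp
    rw [show ((2 : ℕ) : ℚ_[2]) = (2 : ℕ) by rfl, Padic.norm_p]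
    norm_num
  · have : ‖((2 : ℕ) : ℚ_[p])‖ = 1 := by
      rw [Padic.norm_natCast_eq_one_iff]
      exact (Nat.coprime_primes (Fact.out : p.Prime) Nat.prime_two).mpr hp
    rw [this]; norm_num

/-- **`p`-adic separation from the ramification locus bounds `‖N‖_p` below, one finite extension
at a time.** For a finite extension `L ⊆ ℚ̄_p` of `ℚ_p` and `ρ > 0` there is `c > 0` such that every
point `P = (x, r) ∈ D_e(L)` (`r^{2k+1} = x(1−x)`) all of whose `ρ`-neighbours (sup-distance in
`ℚ̄_p × ℚ̄_p`) avoid the zeros of `N = −(1−2x)³ + (k+1)r^{k+2} − 2r^{3k+3}` on `D_e(ℚ̄_p)` — the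
ramification points of `t` — satisfies `c ≤ ‖N(P)‖`. Proof: the points of `D_e(L)` with `‖N‖ ≤ 1`
form a compact set (`L` is locally compact and `‖N‖ ≤ 1 ⇒ ‖r‖ ≤ 4`, `‖x‖ ≤ 4^e`), on whose closed
subset of `ρ`-separated points the continuous function `‖N‖` does not vanish. This is the
nonarchimedean twin of the archimedean lower bound ("the compactness of the set of rational points of
`X` over any finite extension of `ℚ_v`", [GenEll] p. 12). [cite: MochizukiGenEll2010, Thm 2.1 proof p.12] -/
theorem exists_pos_le_norm_of_separated (k : ℕ) (L : IntermediateField ℚ_[p] (PadicAlgCl p))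
    [FiniteDimensional ℚ_[p] L] {ρ : ℝ} (hρ : 0 < ρ) :
    ∃ c : ℝ, 0 < c ∧ ∀ P : PadicAlgCl p × PadicAlgCl p, P.1 ∈ L → P.2 ∈ L →
      P.2 ^ (2 * k + 1) = P.1 * (1 - P.1) →
      (∀ Q : PadicAlgCl p × PadicAlgCl p, Q.2 ^ (2 * k + 1) = Q.1 * (1 - Q.1) →
        -(1 - 2 * Q.1) ^ 3 + (((k : PadicAlgCl p) + 1) * Q.2 ^ (k + 2) - 2 * Q.2 ^ (3 * k + 3)) = 0 →
        ρ ≤ dist P Q) →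
      c ≤ ‖-(1 - 2 * P.1) ^ 3 + (((k : PadicAlgCl p) + 1) * P.2 ^ (k + 2) - 2 * P.2 ^ (3 * k + 3))‖ := by
  classical
  haveI : ProperSpace L := FiniteDimensional.proper ℚ_[p] L
  set Nf : PadicAlgCl p × PadicAlgCl p → PadicAlgCl p := fun Q =>
    -(1 - 2 * Q.1) ^ 3 + (((k : PadicAlgCl p) + 1) * Q.2 ^ (k + 2) - 2 * Q.2 ^ (3 * k + 3)) with hNf
  let ι : L × L → PadicAlgCl p × PadicAlgCl p := fun P => ((P.1 : PadicAlgCl p), (P.2 : PadicAlgCl p))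
  have hι : Continuous ι :=
    (continuous_subtype_val.comp continuous_fst).prodMk (continuous_subtype_val.comp continuous_snd)
  have hNc : Continuous Nf := by simp only [hNf]; fun_prop
  let Z : Set (PadicAlgCl p × PadicAlgCl p) := {Q | Q.2 ^ (2 * k + 1) = Q.1 * (1 - Q.1) ∧ Nf Q = 0}
  let T : Set (L × L) := {P | (ι P).2 ^ (2 * k + 1) = (ι P).1 * (1 - (ι P).1) ∧ ‖Nf (ι P)‖ ≤ 1 ∧
    ∀ Q ∈ Z, ρ ≤ dist (ι P) Q}
  -- `T` is closed
  have hTclosed : IsClosed T := by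
    refine (isClosed_eq ?_ ?_).inter ((isClosed_le (continuous_norm.comp (hNc.comp hι))
      continuous_const).inter ?_)
    · exact (continuous_snd.comp hι).pow _
    · exact (continuous_fst.comp hι).mul (continuous_const.sub (continuous_fst.comp hι))
    · have hc : IsClosed (⋂ Q ∈ Z, {P : L × L | ρ ≤ dist (ι P) Q}) :=
        isClosed_biInter fun Q _ => isClosed_le continuous_const (hι.dist continuous_const)
      convert hc using 1
      ext P
      simp only [Set.mem_iInter, Set.mem_setOf_eq]
      rfl
  -- `T` is bounded (`‖N‖ ≤ 1 ⇒ ‖r‖ ≤ 4 ⇒ ‖x‖ ≤ 4^e`)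
  have hTbdd : Bornology.IsBounded T := by
    refine (isBounded_closedBall (x := (0 : L × L)) (r := 4 ^ (2 * k + 1))).subset ?_
    intro P hP
    rw [mem_closedBall, dist_zero_right]
    obtain ⟨hcv, hN1, -⟩ := hP
    have hr4 : ‖(P.2 : PadicAlgCl p)‖ ≤ 4 := norm_snd_le_four (half_le_norm_two p) k hcv hN1
    have hx : ‖(P.1 : PadicAlgCl p)‖ ≤ 4 ^ (2 * k + 1) := norm_fst_le k hcv hr4
    have h44 : (4 : ℝ) ≤ 4 ^ (2 * k + 1) := le_self_pow₀ (by norm_num) (by omega)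
    rw [Prod.norm_def]
    exact max_le hx (hr4.trans h44)
  have hTcpt : IsCompact T := isCompact_of_isClosed_isBounded hTclosed hTbdd
  -- the positive function `‖N‖`
  let g : L × L → ℝ := fun P => ‖Nf (ι P)‖
  have hg : Continuous g := continuous_norm.comp (hNc.comp hι)
  have hgpos : ∀ P ∈ T, 0 < g P := by
    intro P hP
    obtain ⟨hcv, -, hsep⟩ := hP
    by_contra h0
    have h0' : Nf (ι P) = 0 := by
      have : ‖Nf (ι P)‖ = 0 := le_antisymm (not_lt.mp h0) (norm_nonneg _)
      exact norm_eq_zero.mp this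
    have := hsep (ι P) ⟨hcv, h0'⟩
    rw [dist_self] at this
    exact absurd this (not_le.mpr hρ)
  by_cases hT : T.Nonempty
  · obtain ⟨P₀, hP₀, hmin⟩ := hTcpt.exists_isMinOn hT hg.continuousOn
    refine ⟨min 1 (g P₀), lt_min one_pos (hgpos P₀ hP₀), fun P h1 h2 hcv hsep => ?_⟩
    set P' : L × L := (⟨P.1, h1⟩, ⟨P.2, h2⟩) with hP'
    have hιP : ι P' = P := rfl
    by_cases hle : ‖Nf P‖ ≤ 1
    · have hP'T : P' ∈ T := by
        refine ⟨?_, ?_, fun Q hQ => ?_⟩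
        · rw [hιP]; exact hcv
        · rw [hιP]; exact hle
        · rw [hιP]; exact hsep Q hQ.1 hQ.2
      calc min 1 (g P₀) ≤ g P₀ := min_le_right _ _
        _ ≤ g P' := hmin hP'T
        _ = ‖Nf P‖ := by simp only [g, hιP]
    · exact (min_le_left _ _).trans (le_of_lt (not_le.mp hle))
  · refine ⟨1, one_pos, fun P h1 h2 hcv hsep => ?_⟩
    by_contra hlt
    rw [not_le] at hlt
    exact hT ⟨(⟨P.1, h1⟩, ⟨P.2, h2⟩), hcv, hlt.le, fun Q hQ => hsep Q hQ.1 hQ.2⟩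

/-- **The `p`-adic separation lemma for number fields of bounded degree** (GenEllTwo package
W5b, nonarchimedean half; the input `hbad` of the place-wise κ-summation after the
embeddings-to-places dictionary `PadicEmbedding.sum_toNat_ord_mul_logNorm_le_of_forall_embedding`):
for every prime `p`, `k`, degree bound `d` and `ρ > 0` there is `c > 0` such that for every number
field `F` with `[F:ℚ] ≤ d`, every `(x, r) ∈ D_e(F)` and every embedding `σ : F → ℚ̄_p` whose image
point `(σ x, σ r)` is `ρ`-far from the zeros of `N` on `D_e(ℚ̄_p)`, `c ≤ ‖σ(N(x, r))‖`. (All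
`ℚ̄_p`-conjugates in degree `≤ d` lie in one finite `L/ℚ_p`, `exists_intermediateField_forall_conj_mem`.)
[cite: MochizukiGenEll2010, Thm 2.1 proof p.12] -/
theorem exists_pos_le_norm_embedding_of_separated (k d : ℕ) {ρ : ℝ} (hρ : 0 < ρ) :
    ∃ c : ℝ, 0 < c ∧ ∀ (F : Type) [Field F] [NumberField F], Module.finrank ℚ F ≤ d →
      ∀ (x r : F), r ^ (2 * k + 1) = x * (1 - x) → ∀ σ : F →+* PadicAlgCl p,
        (∀ Q : PadicAlgCl p × PadicAlgCl p, Q.2 ^ (2 * k + 1) = Q.1 * (1 - Q.1) →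
          -(1 - 2 * Q.1) ^ 3 + (((k : PadicAlgCl p) + 1) * Q.2 ^ (k + 2) - 2 * Q.2 ^ (3 * k + 3)) = 0 →
          ρ ≤ dist (σ x, σ r) Q) →
        c ≤ ‖σ (-(1 - 2 * x) ^ 3 + (((k : F) + 1) * r ^ (k + 2) - 2 * r ^ (3 * k + 3)))‖ := by
  obtain ⟨L, hLfd, hL⟩ := exists_intermediateField_forall_conj_mem p d
  haveI : FiniteDimensional ℚ_[p] L := hLfd
  obtain ⟨c, hc, h⟩ := exists_pos_le_norm_of_separated p k L hρ
  refine ⟨c, hc, fun F _ _ hF x r hcv σ hsep => ?_⟩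
  have hcv' : (σ r) ^ (2 * k + 1) = σ x * (1 - σ x) := by
    have := congrArg σ hcv
    simpa [map_pow, map_mul, map_sub, map_one] using this
  have hmap : σ (-(1 - 2 * x) ^ 3 + (((k : F) + 1) * r ^ (k + 2) - 2 * r ^ (3 * k + 3))) =
      -(1 - 2 * σ x) ^ 3 + (((k : PadicAlgCl p) + 1) * (σ r) ^ (k + 2) - 2 * (σ r) ^ (3 * k + 3)) := by
    simp [map_sub, map_add, map_mul, map_pow, map_neg, map_ofNat, map_natCast]
  rw [hmap]
  exact h (σ x, σ r) (hL F hF σ x) (hL F hF σ r) hcv' hsep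

/-- The same with separation from ANY set `Z ⊇` the zeros of `N` on `D_e(ℚ̄_p)` — e.g. the whole
preimage `E_φ = t⁻¹(B) ⊇ R_t` used by the package (the inclusion is the consumer's input, cf.
`GenEllDeCriticalLocus.zeroSet_eq`). [cite: MochizukiGenEll2010, Thm 2.1 proof p.12] -/
theorem exists_pos_le_norm_embedding_of_separated_of_subset (k d : ℕ) {ρ : ℝ} (hρ : 0 < ρ) :
    ∃ c : ℝ, 0 < c ∧ ∀ (Z : Set (PadicAlgCl p × PadicAlgCl p)),
      (∀ Q : PadicAlgCl p × PadicAlgCl p, Q.2 ^ (2 * k + 1) = Q.1 * (1 - Q.1) →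
        -(1 - 2 * Q.1) ^ 3 + (((k : PadicAlgCl p) + 1) * Q.2 ^ (k + 2) - 2 * Q.2 ^ (3 * k + 3)) = 0 →
        Q ∈ Z) →
      ∀ (F : Type) [Field F] [NumberField F], Module.finrank ℚ F ≤ d →
        ∀ (x r : F), r ^ (2 * k + 1) = x * (1 - x) → ∀ σ : F →+* PadicAlgCl p,
          (∀ Q ∈ Z, ρ ≤ dist (σ x, σ r) Q) →
          c ≤ ‖σ (-(1 - 2 * x) ^ 3 + (((k : F) + 1) * r ^ (k + 2) - 2 * r ^ (3 * k + 3)))‖ := by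
  obtain ⟨c, hc, h⟩ := exists_pos_le_norm_embedding_of_separated p k d hρ
  exact ⟨c, hc, fun Z hZ F _ _ hF x r hcv σ hsep =>
    h F hF x r hcv σ fun Q hQ hN => hsep Q (hZ Q hQ hN)⟩

end DePadic

end Literature.NumberTheory.DiophantineGeometry.GenEll

end
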